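import Summits.NavierStokesRegularity.NavierStokesRegularity.Theorems.HeredityAtOne.Negative.NoSwirlCapThree
import Literature.Analysis.FluidPDE.AxisymNoSwirlSpeedCapEighth

/-!
# The no-swirl speed-cap lever against item 19249 `HeredityAtOne` ALONE with the cap constant
# `0.35356` (`= 1/(2√2)` rounded up; the tree's Biot–Savart constant sharpened from `3`)

Cell `ns-blowup`, seat `ns-blowup-fc-prover-3` (g5). NEGATIVE-LANE support for the route item
`PalasekTowerBreakdown.HeredityAtOne` (`= HeredityAt 1`, stmt-NavierStokesRegularity-19249); additive
twin of refuter5's `NoSwirlCapThree.lean` (K-row K5-15, constant `3`) with the constant of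
`Literature/Analysis/FluidPDE/AxisymBiotSavartSupBoundEighth.lean` (`norm_biotSavart_le_sqrt_div_eight`:
`‖K₃ ∗ ω‖_∞ ≤ √(M ∫‖ω‖/8)`, i.e. `(2√2)⁻¹ = 0.353553… < 0.35356`) carried to the dynamic cap by
`GallaySverak2015.speedCap_eighth` (`AxisymNoSwirlSpeedCapEighth.lean`).

WHY THE NUMBER MATTERS (refuter g12, K-row KJ-16; crux-strategist ns-palasek-19249-cstrat-1,
STRATEGY-CENSUS §Strengthen (e)): the swirl-free slice of a REGISTERED level-`k` stage carries the
floor `‖u(τ_k, x)‖ ≥ c₁ Y_k` somewhere, while kinematically `‖u(τ_k)‖_∞ ≤ K · G` with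
`G = √(√((∫η)(∫r²η)) M)` and `K` the Biot–Savart constant; so the door `C · G < c₁ Y_{k+1}` of the
`_C` lever is inhabitable only if `Y_{k+1}/Y_k > K_sharp / C`-type inequalities hold — at `C = 3` the
doors at `k = 1 … 4` are EMPTY BY INEQUALITY (KJ-16: elementary `K ≤ 0.942`; `k ≤ 13` at the sharp
`K* = √3/8`), at `C = 0.35356 ∈ [0.2105, 0.4652)` the `k = 1` door is open for near-extremal
(Hill-type) slices (`Y₂/Y₁ = 2.21`). Nothing is refuted: the premise (a REGISTERED level-1 stage with
such a slice) remains EMPTY-IN-PRACTICE (K61 / S-RING-1); the design-free variant (S⁺,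
`SliceHeredityAtOne` of the strategy census) is the crux-strategist's target, not this file's.

* `isNoSwirlCapConstant_eighth : IsNoSwirlCapConstant 0.35356`;
* `not_heredityAt_of_signedNoSwirlSlice_eighth`, `heredityAtOne_false_of_signedNoSwirlSlice_eighth`
  (route decl by name), `noSwirlCappedStageAtOne_of_eighth` — the `_three` statements with `3 ↦ 0.35356`
  (they imply the `_three` ones, `0.35356 ≤ 3`).

LABEL: kernel bookkeeping; no named fact; nothing constructed. WHAT THIS IS NOT: not Navier–Stokes
evidence either way.

References: Th. Gallay, V. Šverák, Confluentes Math. 7 (2015) = arXiv:1510.01036, Prop. 2.6 (2.14),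
Lemma 5.1, Lemma 6.4 [cite: GallaySverak2016, Prop. 2.6 (2.14), Lemma 5.1, Lemma 6.4 (arXiv pp. 8, 16, 19)];
S. Palasek, arXiv:2605.13827 §4 [cite: Palasek2026ElementaryModel, §4].
-/

noncomputable section

namespace Summit.NavierStokesRegularity.HeredityAtOneNoSwirlCap

open Set MeasureTheory
open scoped ENNReal
open Literature.Analysis.FluidPDE
open Summit.NavierStokesRegularity.FluidComputer.PalasekTowerClayBridge
open Summit.NavierStokesRegularity.NavierStokesRegularity

/-- **`0.35356` is a no-swirl cap constant** (`GallaySverak2015.speedCap_eighth`: both GS15 inputs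
discharged, Biot–Savart constant `1/(2√2)` in the tree's normalisation).
[cite: GallaySverak2016, Prop. 2.6 (2.14), Lemma 5.1, Lemma 6.4 (arXiv pp. 8, 16, 19)] -/
theorem isNoSwirlCapConstant_eighth : IsNoSwirlCapConstant 0.35356 :=
  ⟨by norm_num, GallaySverak2015.speedCap_eighth⟩

/-- **ONE HAND-OVER, WITH THE NUMBER `0.35356`**: a registered stage at a level `k ≥ 1` of a pinned
rigid quiet wide design whose `τ_k`-slice is single-signed swirl-free with
`0.35356 · √(√((∫η)(∫r²η)) · M) < c₁ Y_{k+1}` (`η = ω_θ/r` of the slice, `0 ≤ η ≤ M`) refutes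
`HeredityAt k` — no named fact (`not_heredityAt_of_noSwirlCappedStage` at `C := 0.35356`).
[cite: GallaySverak2016, Prop. 2.6 (2.14)] [cite: Palasek2026ElementaryModel, §4] -/
theorem not_heredityAt_of_signedNoSwirlSlice_eighth {k : ℕ} (hk : 1 ≤ k)
    {S : Schedule TowerRates.wide} (hP : S.Pins 8 (6 / 5)) (hR : S.Rigid) (hQ : S.Quiet)
    (s : Stage 1 TowerRates.wide S (Margins.routeG TowerRates.wide) k) {M : ℝ}
    (hsl : SignedNoSwirlSlice (s.u (S.τ k)) M)
    (hlt : 0.35356 * Real.sqrt (Real.sqrt ((∫ y, angVortQuot (s.u (S.τ k)) y) *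
        ∫ y, cylRadius y ^ 2 * angVortQuot (s.u (S.τ k)) y) * M) <
      S.c₁ * TowerRates.wide.Y (k + 1)) :
    ¬ HeredityAt k :=
  not_heredityAt_of_noSwirlCappedStage hk isNoSwirlCapConstant_eighth hP hR hQ s hsl hlt

/-- **Item 19249 `PalasekTowerBreakdown.HeredityAtOne` ALONE, with the number `0.35356`** (route decl
by name): ONE registered LEVEL-1 stage of a pinned rigid quiet wide design whose `τ₁`-slice is
single-signed swirl-free with `0.35356 · √(√((∫η)(∫r²η)) · M) < c₁ Y₂` refutes it. No named fact.
Premise empty-in-practice. [cite: GallaySverak2016, Prop. 2.6 (2.14)] [cite: Palasek2026ElementaryModel, §4] -/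
theorem heredityAtOne_false_of_signedNoSwirlSlice_eighth {S : Schedule TowerRates.wide}
    (hP : S.Pins 8 (6 / 5)) (hR : S.Rigid) (hQ : S.Quiet)
    (s : Stage 1 TowerRates.wide S (Margins.routeG TowerRates.wide) 1) {M : ℝ}
    (hsl : SignedNoSwirlSlice (s.u (S.τ 1)) M)
    (hlt : 0.35356 * Real.sqrt (Real.sqrt ((∫ y, angVortQuot (s.u (S.τ 1)) y) *
        ∫ y, cylRadius y ^ 2 * angVortQuot (s.u (S.τ 1)) y) * M) <
      S.c₁ * TowerRates.wide.Y 2) :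
    ¬ Theses.PalasekTowerBreakdown.HeredityAtOne := fun h =>
  not_heredityAt_of_signedNoSwirlSlice_eighth le_rfl hP hR hQ s hsl hlt (heredityAtOne_iff.1 h)

/-- **The witness class `NoSwirlCappedStageAtOne` is met with `C := 0.35356`** by any registered
level-1 stage of a pinned rigid quiet wide design with a single-signed swirl-free `τ₁`-slice below the
level-2 floor in the sharpened cap. [cite: GallaySverak2016, Prop. 2.6 (2.14)] -/
theorem noSwirlCappedStageAtOne_of_eighth {S : Schedule TowerRates.wide}
    (hP : S.Pins 8 (6 / 5)) (hR : S.Rigid) (hQ : S.Quiet)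
    (s : Stage 1 TowerRates.wide S (Margins.routeG TowerRates.wide) 1) {M : ℝ}
    (hsl : SignedNoSwirlSlice (s.u (S.τ 1)) M)
    (hlt : 0.35356 * Real.sqrt (Real.sqrt ((∫ y, angVortQuot (s.u (S.τ 1)) y) *
        ∫ y, cylRadius y ^ 2 * angVortQuot (s.u (S.τ 1)) y) * M) <
      S.c₁ * TowerRates.wide.Y 2) :
    NoSwirlCappedStageAtOne :=
  ⟨0.35356, isNoSwirlCapConstant_eighth, S, s, M, hP, hR, hQ, hsl, hlt⟩

end Summit.NavierStokesRegularity.HeredityAtOneNoSwirlCap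

end
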